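import Literature.AlgebraicGeometry.Motives.HodgeNumberFamilySemicontinuity
import Literature.AlgebraicGeometry.Motives.HodgeDecompositionIsInternalDischarge
import Literature.AlgebraicGeometry.HodgeTheory.HodgeModelChernNormalised
import HarnessLib

/-!
# The Hodge model of a smooth projective variety ON ITS OWN COMPLEX POINTS, with the algebraic charts
# and de Rham's integration comparison

Family `hodge`, layer `Literature/AlgebraicGeometry/HodgeTheory`. ONE definition (`algebraicModel`) and
its unfolding / structural lemmas; no named fact. Written by the prover seat `hodge-nonav-20241-p1` (g17,
cell `hodge-nonav`) as brick F-E of prover-Ax's programme «B4 RELATIVE RESIDUES» (route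
`HodgeConjecture/CyclicUnitaryPowers`; memo `PROGRAMME-B4-RELATIVE-RESIDUES-Ax-g12`).

A `HodgeModel n X` (`RationalHodgeClasses`) packages SOME analytification `X^an → X(ℂ)` of the smooth
projective `X` together with a natural complex de Rham comparison over its model space and the Hodge
decomposition; the models produced by `nonempty_hodgeModel_holds`, `stdModel`,
`BettiUniverse.realHodgeModel` have an unspecified carrier (a chosen GAGA analytification) or an
unspecified comparison. For the study of a FAMILY `f : 𝒳 ⟶ S` one wants, for every fibre, a model
whose carrier is LITERALLY the space of complex points `X(ℂ)` — so that the fibre inclusion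
`X_t(ℂ) → 𝒳(ℂ)` is the structure map on the nose — charted by Serre's holomorphic ALGEBRAIC charts
(`ComplexPoints.algebraicChart`, GAGA §2 n°5; complex manifold structure
`Motives.isManifold_algebraicChart`, analytification `Motives.isAnalytification_algebraicChart`), with
the COMMON model space `ℂⁿ = Fin n → ℂ` and de Rham's INTEGRATION comparison
`(integrationDeRhamIsoFamily ℂⁿ) ⊗ ℂ` (natural, multiplicative, normalised: Warner Thm. 4.17/5.36/5.45),
so that top classes pair with cycles by integration (`BettiUniverse.exists_trC_eq_mul_cintegral`).

* `algebraicModel hX : HodgeModel n X` — that model. Its Hodge decomposition is the tree's theorem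
  for compact Kähler manifolds (`Motives.isInternal_hodgePQ_holds`, Voisin I Prop. 6.11), `X(ℂ)` with
  the algebraic charts being Kähler by restriction of the Fubini–Study metric along a projective
  embedding (`isKaehlerManifold_of_isAnalytification_of_isClosedImmersion_holds`).
* `algebraicModel_model`, `_carrier`, `_toComplexPoints`, `_deRham` — the four fields reduce by `rfl`
  to `Fin n → ℂ`, `ComplexPoints X`, `id`, `(integrationDeRhamIsoFamily (Fin n → ℂ)).complexify`.
* `algebraicModel_isChernNormalised`, `algebraicModel_isReal`, `algebraicModel_isHodgeSymmetric`,
  `compactSpace_algebraicModel`.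

## References

* [SerreGAGA1956] J.-P. Serre, Géométrie algébrique et géométrie analytique, Ann. Inst. Fourier 6
  (1956), §2 n°5 Prop. 2, n°6.
* [VoisinHodgeI2002] C. Voisin, Hodge Theory and Complex Algebraic Geometry I (2002), §3.3.2
  Lemma 3.16, §4.3.2 Rem. 4.48, §6.1.3 Prop. 6.11 and Cor. 6.12.
* [WarnerGTM94] F. Warner, Foundations of Differentiable Manifolds and Lie Groups (1983), Thm. 5.36,
  Thm. 5.45.
-/

noncomputable section

open scoped Manifold ContDiff
open CategoryTheory AlgebraicGeometry
open Literature.NumberTheory.Transcendental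
open Literature.Geometry.Kaehler

namespace Literature.AlgebraicGeometry.HodgeTheory

section HodgeTheory

variable {n : ℕ} {X : Motives.SchemeOver ℂ}

/-- **The Hodge decomposition of `X(ℂ)` read in the algebraic charts**: for `X` smooth projective of
dimension `n`, `H^k_dR(X(ℂ); ℂ) = ⨁_{p+q=k} H^{p,q}` for the complex manifold structure given by the
holomorphic algebraic charts (Voisin I Prop. 6.11 for compact Kähler manifolds, the tree's
`Motives.isInternal_hodgePQ_holds`; `X(ℂ)` is compact and Kähler, the latter by
`isKaehlerManifold_of_isAnalytification_of_isClosedImmersion_holds` for the analytification `id`).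
[cite: VoisinHodgeI2002, §6.1.3 Prop. 6.11 and §3.3.2 Lemma 3.16] -/
theorem isInternal_hodgePQ_algebraicChart (hX : Motives.IsSmoothProjective n X) (k : ℕ) :
    letI := hX.smoothOfRelativeDimension
    letI : Smooth X.hom := SmoothOfRelativeDimension.smooth n _
    letI : LocallyOfFiniteType X.hom := inferInstance
    letI := chartedSpaceOfCharts (Motives.ComplexPoints.algebraicChart X n)
      (Motives.ComplexPoints.mem_algebraicChart_source X n)
    DirectSum.IsInternal fun pq : ↥(Finset.antidiagonal k) ↦
      hodgePQ (Fin n → ℂ) (Motives.ComplexPoints X) k pq.1.1 pq.1.2 := by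
  haveI := hX.smoothOfRelativeDimension
  haveI : Smooth X.hom := SmoothOfRelativeDimension.smooth n _
  haveI : LocallyOfFiniteType X.hom := inferInstance
  letI := chartedSpaceOfCharts (Motives.ComplexPoints.algebraicChart X n)
    (Motives.ComplexPoints.mem_algebraicChart_source X n)
  haveI : IsManifold 𝓘(ℂ, Fin n → ℂ) ω (Motives.ComplexPoints X) := Motives.isManifold_algebraicChart X n
  haveI : IsManifold 𝓘(ℝ, Fin n → ℂ) ∞ (Motives.ComplexPoints X) :=
    isManifold_real_of_isManifold_complex
  haveI : CompactSpace (Motives.ComplexPoints X) := Motives.ComplexPoints.compactSpace_of_isSmoothProjective hX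
  haveI : T2Space (Motives.ComplexPoints X) := Motives.ComplexPoints.t2Space_of_isSmoothProjective hX
  obtain ⟨N, ι, hι⟩ := hX.isProjectiveOver
  haveI := hι
  haveI : IsKaehlerManifold (Fin n → ℂ) (Motives.ComplexPoints X) :=
    Motives.isKaehlerManifold_of_isAnalytification_of_isClosedImmersion_holds ι
      (Motives.isAnalytification_algebraicChart X n)
  exact Motives.isInternal_hodgePQ_holds k

/-- **The algebraic-chart Hodge model of a smooth projective `X/ℂ`**: carrier `X(ℂ)` itself with
Serre's holomorphic algebraic charts (model space `ℂⁿ`), structure map `id`, comparison de Rham's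
integration isomorphism complexified `(integrationDeRhamIsoFamily ℂⁿ) ⊗ ℂ` (natural:
`integrationDeRhamIsoFamily_isNatural`, `DeRhamIsoFamily.complexify_isNatural`), Hodge decomposition
`isInternal_hodgePQ_algebraicChart`. A `def` built as a structure literal, so that `.model`,
`.carrier`, `.toComplexPoints`, `.deRham` are `Fin n → ℂ`, `ComplexPoints X`, `id`,
`(integrationDeRhamIsoFamily _).complexify` DEFINITIONALLY. [cite: SerreGAGA1956, §2 n°5 Prop. 2 and n°6]
[cite: VoisinHodgeI2002, §4.3.2 Rem. 4.48 and §6.1.3 Prop. 6.11] -/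
def algebraicModel (hX : Motives.IsSmoothProjective n X) : HodgeModel n X :=
  haveI := hX.smoothOfRelativeDimension
  haveI : Smooth X.hom := SmoothOfRelativeDimension.smooth n _
  haveI : LocallyOfFiniteType X.hom := inferInstance
  letI cs : ChartedSpace (Fin n → ℂ) (Motives.ComplexPoints X) :=
    chartedSpaceOfCharts (Motives.ComplexPoints.algebraicChart X n)
      (Motives.ComplexPoints.mem_algebraicChart_source X n)
  haveI : IsManifold 𝓘(ℂ, Fin n → ℂ) ω (Motives.ComplexPoints X) := Motives.isManifold_algebraicChart X n
  haveI : CompactSpace (Motives.ComplexPoints X) := Motives.ComplexPoints.compactSpace_of_isSmoothProjective hX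
  { model := Fin n → ℂ
    carrier := Motives.ComplexPoints X
    chartedSpace := cs
    isManifold := Motives.isManifold_algebraicChart X n
    isManifold_real := isManifold_real_of_isManifold_complex
    t2Space := Motives.ComplexPoints.t2Space_of_isSmoothProjective hX
    sigmaCompactSpace := inferInstance
    toComplexPoints := id
    isAnalytification := Motives.isAnalytification_algebraicChart X n
    deRham := (integrationDeRhamIsoFamily (Fin n → ℂ)).complexify
    deRham_isNatural := DeRhamIsoFamily.complexify_isNatural integrationDeRhamIsoFamily_isNatural
    isInternal_hodgePQ := isInternal_hodgePQ_algebraicChart hX }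

/-- The model space of the algebraic-chart model is literally `ℂⁿ` (GAGA §2 n°5: charts valued in `ℂⁿ`).
[cite: SerreGAGA1956, §2 n°5 Prop. 2] -/
@[simp]
theorem algebraicModel_model (hX : Motives.IsSmoothProjective n X) :
    (algebraicModel hX).model = (Fin n → ℂ) := rfl

/-- The carrier of the algebraic-chart model is literally `X(ℂ)` (GAGA §2: `Xʰ` has underlying set `X(ℂ)`).
[cite: SerreGAGA1956, §2 n°5 Prop. 2] -/
@[simp]
theorem algebraicModel_carrier (hX : Motives.IsSmoothProjective n X) :
    (algebraicModel hX).carrier = Motives.ComplexPoints X := rfl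

/-- The structure map of the algebraic-chart model is the identity of `X(ℂ)`.
[cite: SerreGAGA1956, §2 n°5 Prop. 2] -/
@[simp]
theorem algebraicModel_toComplexPoints (hX : Motives.IsSmoothProjective n X) :
    (algebraicModel hX).toComplexPoints = id := rfl

/-- The structure map of the algebraic-chart model, pointwise. [cite: SerreGAGA1956, §2 n°5 Prop. 2] -/
@[simp]
theorem algebraicModel_toComplexPoints_apply (hX : Motives.IsSmoothProjective n X)
    (P : (algebraicModel hX).carrier) : (algebraicModel hX).toComplexPoints P = P := rfl

/-- The comparison of the algebraic-chart model is de Rham's integration isomorphism, complexified.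
[cite: VoisinHodgeI2002, §4.3.2 Rem. 4.48] -/
theorem algebraicModel_deRham (hX : Motives.IsSmoothProjective n X) :
    (algebraicModel hX).deRham = (integrationDeRhamIsoFamily (Fin n → ℂ)).complexify := rfl

/-- The algebraic-chart model is Chern-normalised (its comparison IS the integration family).
[cite: VoisinHodgeI2002, §4.3.2 Rem. 4.48] -/
theorem algebraicModel_isChernNormalised (hX : Motives.IsSmoothProjective n X) :
    (algebraicModel hX).IsChernNormalised := rfl

/-- The algebraic-chart model is real (complex conjugation of forms matches conjugation of classes).
[cite: VoisinHodgeI2002, §6.1.3 Cor. 6.12] -/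
theorem algebraicModel_isReal (hX : Motives.IsSmoothProjective n X) : (algebraicModel hX).IsReal :=
  (algebraicModel_isChernNormalised hX).isReal

/-- The algebraic-chart model is Hodge symmetric: `conj H^{p,q} = H^{q,p}`.
[cite: VoisinHodgeI2002, §6.1.3 Cor. 6.12] -/
theorem algebraicModel_isHodgeSymmetric (hX : Motives.IsSmoothProjective n X) :
    (algebraicModel hX).IsHodgeSymmetric :=
  (algebraicModel_isChernNormalised hX).isHodgeSymmetric

/-- The carrier `X(ℂ)` of the algebraic-chart model is compact. [cite: SerreGAGA1956, §2 n°6] -/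
theorem compactSpace_algebraicModel (hX : Motives.IsSmoothProjective n X) :
    CompactSpace (algebraicModel hX).carrier :=
  Motives.ComplexPoints.compactSpace_of_isSmoothProjective hX

end HodgeTheory

end Literature.AlgebraicGeometry.HodgeTheory

end
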